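import Mathlib
import Summits.Parity.BatemanHorn.Theorems.IsogenyRedeiLambdaToCountSandwich
import HarnessLib

/-!
# From plain prime-tuple counts to weighted counts (reverse partial summation, sandwich form)

Helper file `--supports stmt-Parity-0870` (crux `PolyMobiusTail`, lead prover-line-stmt-Parity-0870-c8-0,
line `eta-free-multilinear-window`, registered skeleton `Cruxes/PolyMobiusTail/Lines/stub_large.lean` v6):
the abstract engine of the SUMMIT-EQUIVALENCE certificate
`Theorems/PolynomialMobiusPolyMobiusTailSummitEquivalence.lean` (`PolyMobiusTail ↔ BatemanHorn`).

Abstract statement (the converse of `IsogenyRedeiLambdaToCountSandwich.isEquivalent_card_good`): let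
`Λf, w : ℕ → ℝ` with `0 ≤ Λf ≤ w`, `Λf = w` on a set `good`, and `Λf n ≠ 0 ∧ n ∉ good ⇒ n ∈ bad`,
where `#{n ≤ x : bad} ≪ x^{7/8}`, `w(n) ~ D (log n)^k` and `#{1 ≤ n ≤ x : good} ~ C x / (D (log x)^k)`
(`C, D > 0`). Then `Σ_{n ≤ x} Λf(n) ~ C x`.

Proof: the `bad` part of `Σ Λf` is `≪ (log x)^k x^{7/8} + O(1) = o(x)`; for the `good` part
`S₁(x) = Σ_{good, n ≤ x} w(n)` the two partial-summation inequalities of the forward sandwich,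
`(1-t) Q(x) L(x) ≤ (N₀ + x^{1-η}) L(x) + S₁(x)` and `S₁(x) ≤ W₀ + (1+t) L(x) Q(x)`
(`L(x) = D (log x)^k`, `η = t/(2k+2)`, Bernoulli), are read in the reverse direction: `Q L ~ C x`
(the count hypothesis times `L`) forces `|S₁ − C x| ≤ (3C+1) t x` eventually.
-- adapted from Summits/Parity/BatemanHorn/Theorems/IsogenyRedeiLambdaToCountSandwich.lean
-/

open Finset Filter Asymptotics

namespace Summit.Parity.BatemanHorn.Theorems.PolyMobiusTail.SummitEquivalence

open Summit.Parity.BatemanHorn.LambdaToCount (isLittleO_log_pow_mul_rpow)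

/-! ### Reverse sandwich: from the plain count to the weighted count -/

/-- The final arithmetic of the reverse sandwich: from `(1-t) QL ≤ E + S₁`, `S₁ ≤ W₀ + (1+t) QL`,
`|QL − Cx| ≤ tCx`, `E, W₀ ≤ tx` (`0 < t ≤ 1/2`) conclude `|S₁ − Cx| ≤ (3C+1) t x`. [folklore] -/
theorem reverse_sandwich_arith {C t x QL S₁ W₀ E : ℝ} (hC : 0 < C) (ht0 : 0 < t) (ht12 : t ≤ 1 / 2)
    (hx : 0 ≤ x)
    (hU : (1 - t) * QL ≤ E + S₁) (hE : E ≤ t * x)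
    (hLo : S₁ ≤ W₀ + (1 + t) * QL) (hW : W₀ ≤ t * x)
    (hQ : |QL - C * x| ≤ t * (C * x)) :
    |S₁ - C * x| ≤ (3 * C + 1) * t * x := by
  obtain ⟨hQa, hQb⟩ := abs_le.mp hQ
  have hCx : 0 ≤ C * x := by positivity
  have htx : 0 ≤ t * x := by positivity
  have htCx : 0 ≤ t * (C * x) := by positivity
  have h1t : 0 ≤ 1 - t := by linarith
  -- lower bound
  have hlow : C * x - (3 * C + 1) * t * x ≤ S₁ := by
    have h1 : (1 - t) * (C * x - t * (C * x)) ≤ (1 - t) * QL :=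
      mul_le_mul_of_nonneg_left (by linarith) h1t
    have h2 : C * x - 2 * (t * (C * x)) ≤ (1 - t) * (C * x - t * (C * x)) := by nlinarith
    nlinarith
  -- upper bound
  have hup : S₁ ≤ C * x + (3 * C + 1) * t * x := by
    have h1 : (1 + t) * QL ≤ (1 + t) * (C * x + t * (C * x)) :=
      mul_le_mul_of_nonneg_left (by linarith) (by linarith)
    have h2 : t * t * (C * x) ≤ t / 2 * (C * x) := by nlinarith
    nlinarith
  exact abs_le.mpr ⟨by linarith, by linarith⟩

/-- **Count ⇒ weighted count (reverse sandwich).** Let `Λf, w : ℕ → ℝ` with `0 ≤ Λf ≤ w`,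
`Λf = w` on `good`, `Λf n ≠ 0 ∧ n ∉ good ⇒ n ∈ bad`, `#{n ≤ x : bad} ≪ x^{7/8}`,
`w(n) ~ D (log n)^k` and `#{1 ≤ n ≤ x : good} ~ C x / (D (log x)^k)` (`C, D > 0`). Then
`Σ_{n ≤ x} Λf(n) ~ C x`.  Proof: the `bad` part of `Σ Λf` is `≪ (log x)^k x^{7/8} + O(1) = o(x)`;
for the `good` part `S₁(x) = Σ_{good, n ≤ x} w(n)` the two partial-summation inequalities
`(1-t) Q(x) L(x) ≤ (N₀ + x^{1-η}) L(x) + S₁(x)` and `S₁(x) ≤ W₀ + (1+t) L(x) Q(x)` (`L = D (log x)^k`,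
`η = t/(2k+2)`, Bernoulli) of `IsogenyRedeiLambdaToCountSandwich` are read in the reverse direction:
`Q L ~ C x` forces `|S₁ − Cx| ≤ (3C+1) t x` eventually.
-- adapted from Summits/Parity/BatemanHorn/Theorems/IsogenyRedeiLambdaToCountSandwich.lean
[folklore] -/
theorem isEquivalent_sum_of_card_good : ∀ (k : ℕ) (C D K : ℝ), 0 < C → 0 < D →
    ∀ (w Λf : ℕ → ℝ) (good bad : ℕ → Prop) [DecidablePred good] [DecidablePred bad],
    (∀ n, 0 ≤ Λf n) → (∀ n, Λf n ≤ w n) → (∀ n, good n → Λf n = w n) →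
    (∀ n, Λf n ≠ 0 → ¬good n → bad n) →
    (∀ x : ℕ, 1 ≤ x → ((((Finset.Icc 1 x).filter bad).card : ℕ) : ℝ) ≤ K * (x : ℝ) ^ (7 / 8 : ℝ)) →
    Asymptotics.IsEquivalent Filter.atTop (fun n : ℕ => w n) (fun n : ℕ => D * Real.log n ^ k) →
    Asymptotics.IsEquivalent Filter.atTop (fun x : ℕ => ((((Finset.Icc 1 x).filter good).card : ℕ) : ℝ))
      (fun x : ℕ => C * (x : ℝ) / (D * Real.log x ^ k)) →
    Asymptotics.IsEquivalent Filter.atTop (fun x : ℕ => ∑ n ∈ Finset.Icc 1 x, Λf n)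
      (fun x : ℕ => C * (x : ℝ)) := by
  intro k C D K hC hD w Λf good bad _ _ hΛ0 hΛw hgood hbad hK hw hQ
  have hw0 : ∀ n, 0 ≤ w n := fun n => (hΛ0 n).trans (hΛw n)
  have hlog0 : ∀ n : ℕ, 0 ≤ Real.log n := fun n => Real.log_natCast_nonneg n
  have hL0 : ∀ n : ℕ, 0 ≤ D * Real.log n ^ k := fun n => by positivity
  have hLmono : ∀ {n x : ℕ}, 1 ≤ n → n ≤ x → D * Real.log n ^ k ≤ D * Real.log x ^ k := by
    intro n x hn hnx
    have : Real.log n ≤ Real.log x := Real.log_le_log (by exact_mod_cast hn) (by exact_mod_cast hnx)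
    exact mul_le_mul_of_nonneg_left (pow_le_pow_left₀ (hlog0 n) this k) hD.le
  /- Step 1: the non-good part of `Σ Λf` is `o(x)`. -/
  have hw2 : ∀ᶠ n : ℕ in atTop, w n ≤ 2 * (D * Real.log n ^ k) := by
    filter_upwards [hw.isLittleO.def one_pos] with n hn
    simp only [Pi.sub_apply] at hn
    rw [Real.norm_eq_abs, Real.norm_eq_abs, abs_of_nonneg (hL0 n), one_mul] at hn
    linarith [le_abs_self (w n - D * Real.log n ^ k)]
  obtain ⟨N₁, hN₁⟩ := eventually_atTop.mp hw2
  set W₁ := ∑ n ∈ Icc 1 N₁, w n with hW₁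
  have hW₁0 : 0 ≤ W₁ := sum_nonneg fun n _ => hw0 n
  have hS₂ : ∀ x : ℕ, 1 ≤ x → ∑ n ∈ (Icc 1 x).filter (fun n => ¬good n), Λf n ≤
      W₁ + 2 * (D * Real.log x ^ k) * (K * (x : ℝ) ^ (7 / 8 : ℝ)) := by
    intro x hx
    calc ∑ n ∈ (Icc 1 x).filter (fun n => ¬good n), Λf n
        = ∑ n ∈ ((Icc 1 x).filter (fun n => ¬good n)).filter (fun n => Λf n ≠ 0), Λf n :=
          (sum_filter_ne_zero _).symm
      _ ≤ ∑ n ∈ (Icc 1 x).filter bad, Λf n := by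
          apply sum_le_sum_of_subset_of_nonneg
          · intro n hn
            simp only [mem_filter] at hn ⊢
            exact ⟨hn.1.1, hbad n hn.2 hn.1.2⟩
          · exact fun n _ _ => hΛ0 n
      _ ≤ ∑ n ∈ (Icc 1 x).filter bad, w n := sum_le_sum fun n _ => hΛw n
      _ = ∑ n ∈ ((Icc 1 x).filter bad).filter (fun n => n < N₁), w n +
            ∑ n ∈ ((Icc 1 x).filter bad).filter (fun n => ¬n < N₁), w n :=
          (sum_filter_add_sum_filter_not _ _ _).symm
      _ ≤ W₁ + ∑ n ∈ ((Icc 1 x).filter bad).filter (fun n => ¬n < N₁), 2 * (D * Real.log x ^ k) := by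
          apply add_le_add
          · apply sum_le_sum_of_subset_of_nonneg
            · intro n hn
              simp only [mem_filter, mem_Icc] at hn ⊢
              omega
            · exact fun n _ _ => hw0 n
          · refine sum_le_sum fun n hn => ?_
            simp only [mem_filter, mem_Icc, not_lt] at hn
            exact (hN₁ n hn.2).trans (mul_le_mul_of_nonneg_left (hLmono hn.1.1.1 hn.1.1.2) (by norm_num))
      _ ≤ W₁ + #((Icc 1 x).filter bad) * (2 * (D * Real.log x ^ k)) := by
          rw [sum_const, nsmul_eq_mul]
          have hc : (#(((Icc 1 x).filter bad).filter (fun n => ¬n < N₁)) : ℝ) ≤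
              #((Icc 1 x).filter bad) := by
            exact_mod_cast card_le_card (filter_subset _ _)
          have h2L : 0 ≤ 2 * (D * Real.log x ^ k) := by positivity
          linarith [mul_le_mul_of_nonneg_right hc h2L]
      _ ≤ W₁ + (K * (x : ℝ) ^ (7 / 8 : ℝ)) * (2 * (D * Real.log x ^ k)) := by
          have h2L : 0 ≤ 2 * (D * Real.log x ^ k) := by positivity
          linarith [mul_le_mul_of_nonneg_right (hK x hx) h2L]
      _ = W₁ + 2 * (D * Real.log x ^ k) * (K * (x : ℝ) ^ (7 / 8 : ℝ)) := by ring
  have hS₂o : (fun x : ℕ => ∑ n ∈ (Icc 1 x).filter (fun n => ¬good n), Λf n) =o[atTop]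
      fun x : ℕ => (x : ℝ) := by
    have hrhs : (fun x : ℕ => W₁ + 2 * (D * Real.log x ^ k) * (K * (x : ℝ) ^ (7 / 8 : ℝ))) =o[atTop]
        fun x : ℕ => (x : ℝ) := by
      apply IsLittleO.add
      · exact isLittleO_const_left.mpr
          (Or.inr (tendsto_norm_atTop_atTop.comp tendsto_natCast_atTop_atTop))
      · have := (isLittleO_log_pow_mul_rpow (show (7 / 8 : ℝ) < 1 by norm_num) k).const_mul_left
          (2 * D * K)
        refine this.congr' ?_ ?_
        · filter_upwards with x
          ring
        · filter_upwards with x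
          exact Real.rpow_one _
    refine IsBigO.trans_isLittleO ?_ hrhs
    refine IsBigO.of_bound 1 ?_
    filter_upwards [eventually_ge_atTop 1] with x hx
    have h0 : 0 ≤ ∑ n ∈ (Icc 1 x).filter (fun n => ¬good n), Λf n := sum_nonneg fun n _ => hΛ0 n
    rw [Real.norm_eq_abs, Real.norm_eq_abs, abs_of_nonneg h0, one_mul]
    exact (hS₂ x hx).trans (le_abs_self _)
  /- Step 2: `Q · L ~ C x` (multiply the count asymptotic by `L`, eventually positive). -/
  have hLpos : ∀ᶠ x : ℕ in atTop, 0 < D * Real.log x ^ k := by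
    filter_upwards [eventually_ge_atTop 2] with x hx
    have : 0 < Real.log x := Real.log_pos (by exact_mod_cast hx)
    positivity
  have hQL : (fun x : ℕ => (#((Icc 1 x).filter good) : ℝ) * (D * Real.log x ^ k)) ~[atTop]
      fun x => C * (x : ℝ) := by
    have hmul := hQ.mul (IsEquivalent.refl (u := fun x : ℕ => D * Real.log x ^ k) (l := atTop))
    refine hmul.congr_right ?_
    filter_upwards [hLpos] with x hx
    simp only [Pi.mul_apply]
    rw [div_mul_cancel₀ _ hx.ne']
  /- Step 3: `S₁ ~ C x` by the reverse sandwich. -/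
  have hS₁ : (fun x : ℕ => ∑ n ∈ (Icc 1 x).filter good, w n) ~[atTop] fun x => C * (x : ℝ) := by
    refine IsLittleO.trans_isBigO ?_ (isBigO_self_const_mul hC.ne' (fun x : ℕ => (x : ℝ)) atTop)
    rw [isLittleO_iff]
    intro ε hε
    -- the auxiliary parameter `t`
    set t : ℝ := min (1 / 2) (ε / (3 * C + 1)) with ht
    have ht0 : 0 < t := lt_min (by norm_num) (div_pos hε (by positivity))
    have ht12 : t ≤ 1 / 2 := min_le_left _ _
    have htε : (3 * C + 1) * t ≤ ε := by
      have h := min_le_right (1 / 2 : ℝ) (ε / (3 * C + 1))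
      rw [← ht, le_div_iff₀ (by positivity)] at h
      linarith
    -- two-sided control of `w` beyond `N₀`
    have hwt : ∀ᶠ n : ℕ in atTop, (1 - t / 2) * (D * Real.log n ^ k) ≤ w n ∧
        w n ≤ (1 + t / 2) * (D * Real.log n ^ k) := by
      filter_upwards [hw.isLittleO.def (half_pos ht0)] with n hn
      simp only [Pi.sub_apply] at hn
      rw [Real.norm_eq_abs, Real.norm_eq_abs, abs_of_nonneg (hL0 n)] at hn
      obtain ⟨h1, h2⟩ := abs_le.mp hn
      constructor <;> linarith
    obtain ⟨N₀, hN₀⟩ := eventually_atTop.mp hwt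
    set η : ℝ := t / (2 * k + 2) with hη
    have hη0 : 0 < η := by positivity
    have hη1 : η ≤ 1 / 4 := by
      rw [hη, div_le_iff₀ (by positivity)]
      have : (0 : ℝ) ≤ k := by positivity
      nlinarith
    set W₀ := ∑ n ∈ Icc 1 N₀, w n with hW₀
    have hW₀0 : 0 ≤ W₀ := sum_nonneg fun n _ => hw0 n
    -- (Lo): `S₁ x ≤ W₀ + (1 + t) L x Q x`
    have hLo : ∀ x : ℕ, ∑ n ∈ (Icc 1 x).filter good, w n ≤
        W₀ + (1 + t) * ((#((Icc 1 x).filter good) : ℝ) * (D * Real.log x ^ k)) := by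
      intro x
      rw [← sum_filter_add_sum_filter_not ((Icc 1 x).filter good) (fun n => n < N₀)]
      apply add_le_add
      · apply sum_le_sum_of_subset_of_nonneg
        · intro n hn
          simp only [mem_filter, mem_Icc] at hn ⊢
          omega
        · exact fun n _ _ => hw0 n
      · calc ∑ n ∈ ((Icc 1 x).filter good).filter (fun n => ¬n < N₀), w n
            ≤ ∑ n ∈ ((Icc 1 x).filter good).filter (fun n => ¬n < N₀), (1 + t) * (D * Real.log x ^ k) := by
              refine sum_le_sum fun n hn => ?_
              simp only [mem_filter, mem_Icc, not_lt] at hn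
              calc w n ≤ (1 + t / 2) * (D * Real.log n ^ k) := (hN₀ n hn.2).2
                _ ≤ (1 + t) * (D * Real.log x ^ k) :=
                    mul_le_mul (by linarith) (hLmono hn.1.1.1 hn.1.1.2) (hL0 n) (by linarith)
          _ = #(((Icc 1 x).filter good).filter (fun n => ¬n < N₀)) * ((1 + t) * (D * Real.log x ^ k)) := by
              rw [sum_const, nsmul_eq_mul]
          _ ≤ #((Icc 1 x).filter good) * ((1 + t) * (D * Real.log x ^ k)) := by
              refine mul_le_mul_of_nonneg_right ?_ (mul_nonneg (by linarith) (hL0 x))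
              exact_mod_cast card_le_card (filter_subset _ _)
          _ = (1 + t) * ((#((Icc 1 x).filter good) : ℝ) * (D * Real.log x ^ k)) := by ring
    -- (U): `(1 - t) Q x L x ≤ (N₀ + x^{1-η}) L x + S₁ x` for `x ≥ 1`
    have hU : ∀ x : ℕ, 1 ≤ x →
        (1 - t) * ((#((Icc 1 x).filter good) : ℝ) * (D * Real.log x ^ k)) ≤
          ((N₀ : ℝ) + (x : ℝ) ^ (1 - η)) * (D * Real.log x ^ k) + ∑ n ∈ (Icc 1 x).filter good, w n := by
      intro x hx
      have hx0 : (0 : ℝ) < x := by exact_mod_cast hx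
      set G := (Icc 1 x).filter good with hG
      set A := G.filter (fun n : ℕ => n < N₀ ∨ (n : ℝ) < (x : ℝ) ^ (1 - η)) with hA
      set B := G.filter (fun n : ℕ => ¬(n < N₀ ∨ (n : ℝ) < (x : ℝ) ^ (1 - η))) with hB
      have hsplit : (#G : ℝ) = #A + #B := by
        rw [hA, hB]
        exact_mod_cast (card_filter_add_card_filter_not _).symm
      have hAle : (#A : ℝ) ≤ N₀ + (x : ℝ) ^ (1 - η) := by
        have hsub : A ⊆ range N₀ ∪ Icc 1 ⌊(x : ℝ) ^ (1 - η)⌋₊ := by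
          intro n hn
          rw [hA, mem_filter, hG, mem_filter, mem_Icc] at hn
          rw [mem_union, mem_range, mem_Icc]
          rcases hn.2 with h | h
          · exact Or.inl h
          · exact Or.inr ⟨hn.1.1.1, Nat.le_floor h.le⟩
        calc (#A : ℝ) ≤ #(range N₀ ∪ Icc 1 ⌊(x : ℝ) ^ (1 - η)⌋₊) := by
              exact_mod_cast card_le_card hsub
          _ ≤ #(range N₀) + #(Icc 1 ⌊(x : ℝ) ^ (1 - η)⌋₊) := by exact_mod_cast card_union_le _ _
          _ = N₀ + ⌊(x : ℝ) ^ (1 - η)⌋₊ := by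
              rw [card_range, Nat.card_Icc]
              push_cast
              ring
          _ ≤ N₀ + (x : ℝ) ^ (1 - η) := by
              gcongr
              exact Nat.floor_le (Real.rpow_nonneg hx0.le _)
      have hBw : ∀ n ∈ B, (1 - t) * (D * Real.log x ^ k) ≤ w n := by
        intro n hn
        rw [hB, mem_filter, hG, mem_filter, not_or, not_lt, not_lt] at hn
        obtain ⟨⟨-, -⟩, hnN, hnx⟩ := hn
        have hwn := (hN₀ n hnN).1
        have hlogn : (1 - η) * Real.log x ≤ Real.log n := by
          rw [← Real.log_rpow hx0]
          exact Real.log_le_log (Real.rpow_pos_of_pos hx0 _) hnx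
        have h1η : 0 ≤ 1 - η := by linarith
        have hpow : (1 - η) ^ k * Real.log x ^ k ≤ Real.log n ^ k := by
          rw [← mul_pow]
          exact pow_le_pow_left₀ (mul_nonneg h1η (hlog0 x)) hlogn k
        have hbern : 1 - t / 2 ≤ (1 - η) ^ k := by
          have hb := one_add_mul_le_pow (a := -η) (by linarith) k
          have hkη : (k : ℝ) * η ≤ t / 2 := by
            rw [hη, mul_div_assoc', div_le_div_iff₀ (by positivity) (by positivity)]
            nlinarith [ht0.le]
          calc 1 - t / 2 ≤ 1 + k * (-η) := by linarith
            _ ≤ (1 + -η) ^ k := hb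
            _ = (1 - η) ^ k := by ring_nf
        have h12 : 0 ≤ 1 - t / 2 := by linarith
        calc (1 - t) * (D * Real.log x ^ k)
            ≤ (1 - t / 2) * ((1 - t / 2) * (D * Real.log x ^ k)) := by
              have hsq : 0 ≤ t ^ 2 / 4 * (D * Real.log x ^ k) := by positivity
              have : (1 - t / 2) * ((1 - t / 2) * (D * Real.log x ^ k)) =
                  (1 - t) * (D * Real.log x ^ k) + t ^ 2 / 4 * (D * Real.log x ^ k) := by ring
              rw [this]
              linarith
          _ ≤ (1 - t / 2) * ((1 - η) ^ k * (D * Real.log x ^ k)) :=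
              mul_le_mul_of_nonneg_left (mul_le_mul_of_nonneg_right hbern (hL0 x)) h12
          _ = (1 - t / 2) * (D * ((1 - η) ^ k * Real.log x ^ k)) := by ring
          _ ≤ (1 - t / 2) * (D * Real.log n ^ k) :=
              mul_le_mul_of_nonneg_left (mul_le_mul_of_nonneg_left hpow hD.le) h12
          _ ≤ w n := hwn
      have hBsum : (#B : ℝ) * ((1 - t) * (D * Real.log x ^ k)) ≤ ∑ n ∈ G, w n := by
        calc (#B : ℝ) * ((1 - t) * (D * Real.log x ^ k))
            = ∑ _n ∈ B, (1 - t) * (D * Real.log x ^ k) := by rw [sum_const, nsmul_eq_mul]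
          _ ≤ ∑ n ∈ B, w n := sum_le_sum hBw
          _ ≤ ∑ n ∈ G, w n :=
              sum_le_sum_of_subset_of_nonneg (filter_subset _ _) fun n _ _ => hw0 n
      have hA0 : 0 ≤ (#A : ℝ) := by positivity
      have ht1 : 0 ≤ 1 - t := by linarith
      calc (1 - t) * ((#G : ℝ) * (D * Real.log x ^ k))
          = (1 - t) * (#A * (D * Real.log x ^ k)) + #B * ((1 - t) * (D * Real.log x ^ k)) := by
            rw [hsplit]; ring
        _ ≤ 1 * (#A * (D * Real.log x ^ k)) + ∑ n ∈ G, w n :=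
            add_le_add (mul_le_mul_of_nonneg_right (by linarith) (mul_nonneg hA0 (hL0 x))) hBsum
        _ ≤ ((N₀ : ℝ) + (x : ℝ) ^ (1 - η)) * (D * Real.log x ^ k) + ∑ n ∈ G, w n := by
            rw [one_mul]
            exact add_le_add (mul_le_mul_of_nonneg_right hAle (hL0 x)) le_rfl
    -- eventual smallness of the error terms
    have hE1 : ∀ᶠ x : ℕ in atTop, ((N₀ : ℝ) + (x : ℝ) ^ (1 - η)) * (D * Real.log x ^ k) ≤ t * x := by
      have h1 : (fun x : ℕ => ((N₀ : ℝ) + (x : ℝ) ^ (1 - η)) * (D * Real.log x ^ k)) =o[atTop]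
          fun x : ℕ => (x : ℝ) := by
        have hA := isLittleO_log_pow_mul_rpow (show (0 : ℝ) < 1 by norm_num) k
        have hB := isLittleO_log_pow_mul_rpow (show 1 - η < 1 by linarith) k
        have := (hA.const_mul_left (N₀ * D)).add (hB.const_mul_left D)
        refine this.congr' ?_ ?_
        · filter_upwards with x
          rw [Real.rpow_zero]
          ring
        · filter_upwards with x
          exact Real.rpow_one _
      filter_upwards [h1.def ht0] with x hx
      have h0 : 0 ≤ ((N₀ : ℝ) + (x : ℝ) ^ (1 - η)) * (D * Real.log x ^ k) := by
        have := hL0 x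
        positivity
      rw [Real.norm_eq_abs, Real.norm_eq_abs, abs_of_nonneg h0, Nat.abs_cast] at hx
      exact hx
    have hE2 : ∀ᶠ x : ℕ in atTop, W₀ ≤ t * x := by
      filter_upwards [(tendsto_natCast_atTop_atTop (R := ℝ)).eventually_ge_atTop (W₀ / t)] with x hx
      rw [div_le_iff₀ ht0] at hx
      linarith
    have hE3 : ∀ᶠ x : ℕ in atTop,
        |(#((Icc 1 x).filter good) : ℝ) * (D * Real.log x ^ k) - C * x| ≤ t * (C * x) := by
      filter_upwards [hQL.isLittleO.def ht0] with x hx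
      rw [Real.norm_eq_abs, Real.norm_eq_abs, abs_of_nonneg (by positivity : 0 ≤ C * (x : ℝ))] at hx
      exact hx
    filter_upwards [hE1, hE2, hE3, eventually_ge_atTop 1] with x h1 h2 h3 hx1
    have hx0 : (0 : ℝ) ≤ x := by positivity
    rw [Real.norm_eq_abs, Real.norm_eq_abs, abs_of_nonneg hx0]
    refine (reverse_sandwich_arith hC ht0 ht12 hx0 (hU x hx1) h1 (hLo x) h2 h3).trans ?_
    exact mul_le_mul_of_nonneg_right htε hx0
  /- Step 4: `Σ Λf = S₁ + (non-good part)`. -/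
  have heq : ∀ x : ℕ, ∑ n ∈ Icc 1 x, Λf n =
      ∑ n ∈ (Icc 1 x).filter good, w n + ∑ n ∈ (Icc 1 x).filter (fun n => ¬good n), Λf n := by
    intro x
    rw [← sum_filter_add_sum_filter_not (Icc 1 x) good Λf]
    congr 1
    exact sum_congr rfl fun n hn => hgood n (mem_filter.mp hn).2
  have := hS₁.add_isLittleO (hS₂o.trans_isBigO (isBigO_self_const_mul hC.ne' _ _))
  exact this.congr_left (Eventually.of_forall fun x => (heq x).symm)

end Summit.Parity.BatemanHorn.Theorems.PolyMobiusTail.SummitEquivalence
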